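import Summits.CriticalPhenomena.PercolationContinuityZ3.Theorems.FK.PressureDifferentiabilitySet
import Summits.CriticalPhenomena.PercolationContinuityZ3.Theorems.FK.MagnetizationFieldDerivative
import Summits.CriticalPhenomena.PercolationContinuityZ3.Theorems.FK.ImproperSusceptibilitySumRule
import Mathlib.Analysis.Calculus.ContDiff.Deriv
import Mathlib.Data.Real.Sign
import HarnessLib

/-!
# THE ZERO-FIELD REGULARITY OF THE ISING PRESSURE IN THE FIELD, UP TO AND AT CRITICALITY:
# `ψ(β,·) ∈ C¹(ℝ)` for `β ≤ β_c` with `∂ψ/∂h = β sign(h) m(β,|h|)`; TWICE differentiable at `h = 0` with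
# `∂²ψ/∂h²(β,0) = β² χ(β)` for `β < β_c`; NOT twice differentiable at `h = 0` for `β = β_c` (`χ(β_c) = ∞`), so the
# pressure surface is `C¹` but NOT `C²` at the critical point
# (Friedli–Velenik 2017, Prop. 3.29, Thm. 3.34, Thm. 3.43; Aizenman–Barsky–Fernández 1987; Ellis 2006, V.7–V.8)

Claimed R42 (8)(c) in the cell INBOX at 2026-08-29T05:25:08Z by fkp-10a gen 358 (NEW CLAIM #4 of the gen), addressed to coordinator fk-4 gen 292 (seated 04:05Z 2026-08-29 by l.8710; R166 / R167 / R168 in force); lineage row FO-10a-g358c (self-suggested), package g358-critical, label CS-A.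
Helper file of the `fk-continuity` build cell (bschramm lane; `--supports stmt-CriticalPhenomena-4575`); builds on
p205010 (kernel theorem, internal audit signed; external expert review pending). No definitions, no named facts, no
sorries; standard axioms. UNCONDITIONAL (nearest-neighbour Ising model on `ℤ^d`, `d ≥ 2`).

* `deriv_pressure_field_eq_sign` — for `0 ≤ β ≤ β_c` and EVERY real `h`:
  `deriv ψ(β,·) h = β · sign(h) · m(β,|h|)` (the odd extension of `βm`; at `h = 0` both sides vanish, `m*(β) = 0`);
* **`contDiff_one_pressure_field_of_le_criticalBeta`** — `ψ(β,·) ∈ C¹(ℝ)` for `0 < β ≤ β_c(d)` (INCLUDING `β_c`): the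
  derivative `β sign(h) m(β,|h|)` is continuous, at `h = 0` because `m(β,h) → m*(β) = 0`;
* **`hasDerivAt_deriv_pressure_field_zero_of_lt_criticalBeta`** — for `0 < β < β_c`: `ψ(β,·)` is TWICE differentiable
  at `h = 0` with `ψ''(β,0) = β² χ(β)` (the finite susceptibility; odd reflection of the tree's one-sided derivative
  `hasDerivWithinAt_magnetizationInField_zero_of_lt_criticalBeta`);
* **`not_differentiableWithinAt_magnetizationInField_criticalBeta`** — at `β_c` the magnetisation `m(β_c,·)` is not
  differentiable at `0⁺` (infinite slope, `tendsto_magnetizationInField_div_atTop_criticalBeta`), hence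
  **`not_differentiableWithinAt_deriv_pressure_criticalBeta`** — `∂ψ/∂h(β_c,·)` is not differentiable at `0⁺`:
  `ψ(β_c,·)` is `C¹` but NOT twice differentiable at `h = 0` (**`not_contDiffAt_two_pressure_field_criticalBeta`**);
* **`not_contDiffAt_two_pressure_uncurry_criticalBeta`** — the pressure SURFACE `(β,h) ↦ ψ(β,h)` is not `C²` at the
  critical point `(β_c, 0)` (it is differentiable there with gradient continuous along its differentiability set,
  `PressureDifferentiabilitySet` / `PressureGradientContinuity`): the transition at `β_c` is of second order with a
  divergent susceptibility.

## References

* S. Friedli, Y. Velenik, *Statistical Mechanics of Lattice Systems*, CUP (2017), Prop. 3.29, Thm. 3.34, Thm. 3.43,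
  Exercise 3.32. [FriedliVelenik2017]
* M. Aizenman, D. J. Barsky, R. Fernández, *The phase transition in a general class of Ising-type models is sharp*,
  J. Stat. Phys. 47 (1987), Thm. 1 (divergence of `χ` at `β_c`). [AizenmanBarskyFernandezJSP1987]
* R. S. Ellis, *Entropy, Large Deviations, and Statistical Mechanics*, Springer (2006), Lemma V.7.4, Thm. V.8.3.
  [Ellis2006]
-/

noncomputable section

namespace Summit.CriticalPhenomena.PercolationContinuityZ3.Theorems.FK

namespace IsingPressure

open MeasureTheory Filter Topology Finset Set
open Literature.Probability.LatticeModels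
open Summit.CriticalPhenomena.PercolationContinuityZ3.Theorems.FK.IsingSusceptibility

variable {d : ℕ}

/-! ### `∂ψ/∂h` as one formula on the whole line, `β ≤ β_c` -/

/-- **`HasDerivAt ψ(β,·) (β sign(h) m(β,|h|)) h` at EVERY real `h`, for `0 < β ≤ β_c(d)`** (`d ≥ 2`): `h > 0` and
`h < 0` from `hasDerivAt_pressure_field` / `_of_neg`, `h = 0` with derivative `β m*(β) = 0`. [cite: FriedliVelenik2017, Thm. 3.43, Prop. 3.29 and Thm. 3.34] -/
theorem hasDerivAt_pressure_field_sign (hd : 2 ≤ d) {β : ℝ} (hβ : 0 < β) (hβc : β ≤ criticalBeta d) (h : ℝ) :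
    HasDerivAt (fun t => pressure d β t) (β * Real.sign h * magnetizationInField d β |h|) h := by
  rcases lt_trichotomy h 0 with hneg | rfl | hpos
  · rw [Real.sign_of_neg hneg, abs_of_neg hneg]
    have := hasDerivAt_pressure_field_of_neg (d := d) (by omega) hβ.le hneg
    convert this using 1; ring
  · rw [Real.sign_zero, mul_zero, zero_mul]
    have hm : spontaneousMagnetization d β = 0 := spontaneousMagnetization_eq_zero_of_le_criticalBeta_two_le hd hβ.le hβc
    have hR := hasDerivWithinAt_pressure_field_zero (d := d) (by omega) hβ.le
    have hL := hasDerivWithinAt_pressure_field_zero_left (d := d) (by omega) hβ.le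
    rw [hm, mul_zero] at hR hL
    rw [neg_zero] at hL
    have := hL.union hR
    rwa [Iic_union_Ici, hasDerivWithinAt_univ] at this
  · rw [Real.sign_of_pos hpos, abs_of_pos hpos, mul_one]
    exact hasDerivAt_pressure_field (by omega) hβ.le hpos

/-- **`deriv ψ(β,·) h = β sign(h) m(β,|h|)` for every real `h`** (`d ≥ 2`, `0 < β ≤ β_c`). [cite: FriedliVelenik2017, Thm. 3.43 and Prop. 3.29] -/
theorem deriv_pressure_field_eq_sign (hd : 2 ≤ d) {β : ℝ} (hβ : 0 < β) (hβc : β ≤ criticalBeta d) (h : ℝ) :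
    deriv (fun t => pressure d β t) h = β * Real.sign h * magnetizationInField d β |h| :=
  (hasDerivAt_pressure_field_sign hd hβ hβc h).deriv

/-- **`h ↦ β sign(h) m(β,|h|)` is continuous on `ℝ`** for `0 < β ≤ β_c` (`d ≥ 2`; off `0` by the continuity of `m(β,·)`
on `(0,∞)`, at `0` because `|β sign(h) m(β,|h|)| ≤ β m(β,|h|) → β m*(β) = 0`). [cite: FriedliVelenik2017, Lemma 3.31 and Thm. 3.34] -/
theorem continuous_sign_mul_magnetizationInField_abs (hd : 2 ≤ d) {β : ℝ} (hβ : 0 < β) (hβc : β ≤ criticalBeta d) :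
    Continuous fun h : ℝ => β * Real.sign h * magnetizationInField d β |h| := by
  refine continuous_iff_continuousAt.2 fun h => ?_
  rcases eq_or_ne h 0 with rfl | hh
  · -- at `h = 0`: squeeze by `β m(β,|h|) → 0`
    have hm0 : magnetizationInField d β 0 = 0 := by
      rw [magnetizationInField_zero]; exact spontaneousMagnetization_eq_zero_of_le_criticalBeta_two_le hd hβ.le hβc
    have hright : Tendsto (fun t => magnetizationInField d β t) (𝓝[≥] 0) (𝓝 0) := by
      have := (continuousWithinAt_magnetizationInField_Ici_zero (d := d) hβ.le).tendsto
      rwa [hm0] at this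
    have habs : Tendsto (fun h : ℝ => magnetizationInField d β |h|) (𝓝 0) (𝓝 0) := by
      have ha : Tendsto (fun h : ℝ => |h|) (𝓝 0) (𝓝[≥] 0) :=
        tendsto_nhdsWithin_iff.2 ⟨by simpa using (continuous_abs.tendsto (0 : ℝ)),
          Eventually.of_forall fun h => abs_nonneg h⟩
      exact hright.comp ha
    rw [ContinuousAt, Real.sign_zero, mul_zero, zero_mul]
    have hb : Tendsto (fun h : ℝ => β * magnetizationInField d β |h|) (𝓝 0) (𝓝 (β * 0)) := habs.const_mul β
    rw [mul_zero] at hb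
    refine squeeze_zero_norm (fun h => ?_) hb
    have hm : 0 ≤ magnetizationInField d β |h| := by
      rw [magnetizationInField_eq_plusCorr]; exact plusCorr_nonneg hβ.le (abs_nonneg _) _
    have hs : |Real.sign h| ≤ 1 := by
      rcases lt_trichotomy h 0 with h' | h' | h'
      · rw [Real.sign_of_neg h']; simp
      · rw [h', Real.sign_zero]; simp
      · rw [Real.sign_of_pos h']; simp
    rw [Real.norm_eq_abs, abs_mul, abs_mul, abs_of_pos hβ, abs_of_nonneg hm]
    calc β * |Real.sign h| * magnetizationInField d β |h| ≤ β * 1 * magnetizationInField d β |h| := by gcongr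
      _ = β * magnetizationInField d β |h| := by ring
  · -- off `0`: `sign` is locally constant and `m(β,·)` is continuous at `|h| > 0`
    have habs : 0 < |h| := abs_pos.2 hh
    have hm1 : ContinuousAt (fun t => magnetizationInField d β t) |h| :=
      (concaveOn_magnetizationInField (d := d) hβ.le).continuousOn_interior.continuousAt
        (by rw [interior_Ici]; exact Ioi_mem_nhds habs)
    have hm : ContinuousAt (fun t : ℝ => magnetizationInField d β |t|) h := by
      have e : (fun t : ℝ => magnetizationInField d β |t|) = (fun t => magnetizationInField d β t) ∘ (fun t : ℝ => |t|) := by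
        funext t; simp only [Function.comp_apply]
      rw [e]
      exact ContinuousAt.comp hm1 continuous_abs.continuousAt
    have hsign : ContinuousAt (fun t : ℝ => Real.sign t) h := by
      refine (continuousAt_const (y := Real.sign h)).congr ?_
      rcases hh.lt_or_gt with hneg | hpos
      · filter_upwards [Iio_mem_nhds hneg] with t ht
        rw [Real.sign_of_neg hneg, Real.sign_of_neg ht]
      · filter_upwards [Ioi_mem_nhds hpos] with t ht
        rw [Real.sign_of_pos hpos, Real.sign_of_pos ht]
    exact (continuousAt_const.mul hsign).mul hm

/-- **`ψ(β,·) ∈ C¹(ℝ)` FOR `0 < β ≤ β_c(d)`, INCLUDING `β_c`** (`d ≥ 2`): differentiable everywhere with the continuous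
derivative `β sign(h) m(β,|h|)`. (For `β > β_c` it is not even differentiable at `0`:
`not_differentiableAt_pressure_zero_of_criticalBeta_lt`.) [cite: FriedliVelenik2017, Thm. 3.34, Thm. 3.43 and Prop. 3.29] -/
theorem contDiff_one_pressure_field_of_le_criticalBeta (hd : 2 ≤ d) {β : ℝ} (hβ : 0 < β) (hβc : β ≤ criticalBeta d) :
    ContDiff ℝ 1 (fun t => pressure d β t) := by
  rw [contDiff_one_iff_deriv]
  refine ⟨fun h => (hasDerivAt_pressure_field_sign hd hβ hβc h).differentiableAt, ?_⟩
  have hfun : deriv (fun t => pressure d β t) = fun h => β * Real.sign h * magnetizationInField d β |h| :=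
    funext fun h => deriv_pressure_field_eq_sign hd hβ hβc h
  rw [hfun]
  exact continuous_sign_mul_magnetizationInField_abs hd hβ hβc

/-! ### Below `β_c`: twice differentiable at `h = 0`, `ψ''(β,0) = β² χ(β)` -/

/-- **For `0 < β < β_c(d)`, `h ↦ sign(h) m(β,|h|)` has derivative `β χ(β)` at `0`** (`d ≥ 2`): the odd extension of
the magnetisation is differentiable at `0` with the finite zero-field susceptibility slope (right derivative
`hasDerivWithinAt_magnetizationInField_zero_of_lt_criticalBeta`, left derivative by reflection). [cite: Ellis2006, Lemma V.7.4 (b); FriedliVelenik2017, Exercise 3.32] -/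
theorem hasDerivAt_sign_mul_magnetizationInField_abs_zero (hd : 2 ≤ d) {β : ℝ} (hβ : 0 < β) (hβc : β < criticalBeta d) :
    HasDerivAt (fun h : ℝ => Real.sign h * magnetizationInField d β |h|) (β * (susceptibility d β).toReal) 0 := by
  have hR0 := hasDerivWithinAt_magnetizationInField_zero_of_lt_criticalBeta hd hβ hβc
  have hm0 : magnetizationInField d β 0 = 0 := by
    rw [magnetizationInField_zero]; exact spontaneousMagnetization_eq_zero_of_le_criticalBeta_two_le hd hβ.le hβc.le
  -- right derivative: the function is `m(β,h)` on `[0,∞)`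
  have hR : HasDerivWithinAt (fun h : ℝ => Real.sign h * magnetizationInField d β |h|) (β * (susceptibility d β).toReal)
      (Ici 0) 0 := by
    refine hR0.congr_of_eventuallyEq ?_ (by simp [hm0])
    filter_upwards [self_mem_nhdsWithin] with h hh
    rcases (mem_Ici.1 hh).eq_or_lt with rfl | hpos
    · simp [hm0]
    · rw [Real.sign_of_pos hpos, abs_of_pos hpos, one_mul]
  -- left derivative: the function is `-m(β,-h)` on `(-∞,0]`
  have hL : HasDerivWithinAt (fun h : ℝ => Real.sign h * magnetizationInField d β |h|) (β * (susceptibility d β).toReal)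
      (Iic 0) 0 := by
    have hneg : HasDerivWithinAt (fun h : ℝ => -h) (-1) (Iic 0) 0 := (hasDerivAt_neg 0).hasDerivWithinAt
    have hmaps : MapsTo (fun h : ℝ => -h) (Iic 0) (Ici 0) := fun h hh => by simpa using hh
    have hR0' : HasDerivWithinAt (fun t => magnetizationInField d β t) (β * (susceptibility d β).toReal) (Ici 0) (-0) := by
      simpa using hR0
    have hcomp := (hR0'.comp 0 hneg hmaps).neg
    have hcomp' : HasDerivWithinAt (fun h : ℝ => -magnetizationInField d β (-h)) (β * (susceptibility d β).toReal)
        (Iic 0) 0 := by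
      have e : (β * (susceptibility d β).toReal) = -(β * (susceptibility d β).toReal * -1) := by ring
      rw [e]
      refine hcomp.congr_of_eventuallyEq (Eventually.of_forall fun h => ?_) ?_ <;>
        simp only [Pi.neg_apply, Function.comp_apply]
    refine hcomp'.congr_of_eventuallyEq ?_ (by simp [hm0])
    filter_upwards [self_mem_nhdsWithin] with h hh
    rcases (mem_Iic.1 hh).eq_or_lt with rfl | hneg'
    · simp [hm0]
    · rw [Real.sign_of_neg hneg', abs_of_neg hneg']; ring
  have := hL.union hR
  rwa [Iic_union_Ici, hasDerivWithinAt_univ] at this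

/-- **`ψ(β,·)` IS TWICE DIFFERENTIABLE AT `h = 0` FOR `0 < β < β_c(d)`, WITH `ψ''(β,0) = β² χ(β)`** (`d ≥ 2`; `χ(β) < ∞`
below `β_c`). [cite: Ellis2006, Lemma V.7.4 (b) and eq. (5.28); FriedliVelenik2017, Exercise 3.32] -/
theorem hasDerivAt_deriv_pressure_field_zero_of_lt_criticalBeta (hd : 2 ≤ d) {β : ℝ} (hβ : 0 < β)
    (hβc : β < criticalBeta d) :
    HasDerivAt (deriv fun t => pressure d β t) (β ^ 2 * (susceptibility d β).toReal) 0 := by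
  have hfun : deriv (fun t => pressure d β t) = fun h => β * (Real.sign h * magnetizationInField d β |h|) :=
    funext fun h => by rw [deriv_pressure_field_eq_sign hd hβ hβc.le h]; ring
  rw [hfun]
  have e : β ^ 2 * (susceptibility d β).toReal = β * (β * (susceptibility d β).toReal) := by ring
  rw [e]
  exact (hasDerivAt_sign_mul_magnetizationInField_abs_zero hd hβ hβc).const_mul β

/-! ### At `β_c`: `C¹` but not twice differentiable — the divergent susceptibility -/

/-- **The critical magnetisation is not differentiable at `h = 0⁺`** (`d ≥ 2`): `m(β_c,h)/h → ∞` as `h ↓ 0`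
(`tendsto_magnetizationInField_div_atTop_criticalBeta`), so no finite right derivative exists.
[cite: AizenmanBarskyFernandezJSP1987, Thm. 1; Ellis2006, Thm. V.8.3 (d)] -/
theorem not_differentiableWithinAt_magnetizationInField_criticalBeta (hd : 2 ≤ d) :
    ¬ DifferentiableWithinAt ℝ (fun t => magnetizationInField d (criticalBeta d) t) (Ici 0) 0 := by
  intro hD
  have hderiv := hD.hasDerivWithinAt
  have hm0 : magnetizationInField d (criticalBeta d) 0 = 0 := by
    rw [magnetizationInField_zero]
    exact spontaneousMagnetization_eq_zero_of_le_criticalBeta_two_le hd (criticalBeta_pos_holds hd).le le_rfl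
  -- the slope tends to the derivative along `𝓝[>] 0` ...
  have hslope := (hasDerivWithinAt_iff_tendsto_slope.1 hderiv).mono_left
    (nhdsWithin_mono _ (show Ioi (0 : ℝ) ⊆ Ici 0 \ {0} from fun x hx =>
      ⟨mem_Ici.2 (le_of_lt (mem_Ioi.1 hx)), fun h0 => (ne_of_gt (mem_Ioi.1 hx)) (mem_singleton_iff.1 h0)⟩))
  -- ... but it also tends to `+∞`
  have htop := tendsto_magnetizationInField_div_atTop_criticalBeta (d := d) hd
  have heq : (fun h => magnetizationInField d (criticalBeta d) h / h) =ᶠ[𝓝[>] 0]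
      slope (fun t => magnetizationInField d (criticalBeta d) t) 0 := by
    filter_upwards [self_mem_nhdsWithin] with h _
    rw [slope_def_field, hm0, sub_zero, sub_zero]
  exact not_tendsto_atTop_of_tendsto_nhds (hslope.congr' heq.symm) htop

/-- **`∂ψ/∂h(β_c,·)` IS NOT DIFFERENTIABLE AT `h = 0⁺`**: `ψ(β_c,·)` is `C¹` but NOT twice differentiable at `h = 0`
(`deriv ψ(β_c,·) = β_c m(β_c,·)` on `[0,∞)`, infinite slope of the critical isotherm). [cite: AizenmanBarskyFernandezJSP1987, Thm. 1; Ellis2006, Thm. V.8.3; FriedliVelenik2017, Thm. 3.43] -/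
theorem not_differentiableWithinAt_deriv_pressure_criticalBeta (hd : 2 ≤ d) :
    ¬ DifferentiableWithinAt ℝ (deriv fun t => pressure d (criticalBeta d) t) (Ici 0) 0 := by
  have hβ := criticalBeta_pos_holds (d := d) hd
  intro hD
  -- `deriv ψ(β_c,·) h = β_c m(β_c,h)` on `[0,∞)`
  have heq : ∀ h ∈ Ici (0 : ℝ), deriv (fun t => pressure d (criticalBeta d) t) h =
      criticalBeta d * magnetizationInField d (criticalBeta d) h := by
    intro h hh
    rw [deriv_pressure_field_eq_sign hd hβ le_rfl h]
    rcases (mem_Ici.1 hh).eq_or_lt with rfl | hpos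
    · rw [Real.sign_zero, abs_zero, magnetizationInField_zero,
        spontaneousMagnetization_eq_zero_of_le_criticalBeta_two_le hd hβ.le le_rfl]; ring
    · rw [Real.sign_of_pos hpos, abs_of_pos hpos, mul_one]
  have hD' : DifferentiableWithinAt ℝ (fun h => criticalBeta d * magnetizationInField d (criticalBeta d) h) (Ici 0) 0 :=
    hD.congr (fun h hh => (heq h hh).symm) (heq 0 (mem_Ici.2 le_rfl)).symm
  have hD'' : DifferentiableWithinAt ℝ (fun h => magnetizationInField d (criticalBeta d) h) (Ici 0) 0 := by
    have := hD'.const_mul (criticalBeta d)⁻¹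
    refine this.congr (fun h _ => ?_) ?_ <;> field_simp
  exact not_differentiableWithinAt_magnetizationInField_criticalBeta hd hD''

/-- **`ψ(β_c,·)` is NOT `C²` at `h = 0`** (`d ≥ 2`). [cite: AizenmanBarskyFernandezJSP1987, Thm. 1; Ellis2006, Thm. V.8.3] -/
theorem not_contDiffAt_two_pressure_field_criticalBeta (hd : 2 ≤ d) :
    ¬ ContDiffAt ℝ 2 (fun t => pressure d (criticalBeta d) t) 0 := by
  intro h2
  have h1 : ContDiffAt ℝ 1 (deriv fun t => pressure d (criticalBeta d) t) 0 := by
    have := h2.fderiv_right (m := 1) (by norm_num)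
    -- `deriv f = fun x => fderiv f x 1`
    have hcomp : ContDiffAt ℝ 1 (fun x => (fderiv ℝ (fun t => pressure d (criticalBeta d) t) x) (1 : ℝ)) 0 :=
      (ContinuousLinearMap.apply ℝ ℝ (1 : ℝ)).contDiff.contDiffAt.comp 0 this
    refine hcomp.congr_of_eventuallyEq (Eventually.of_forall fun x => ?_)
    simp
  exact not_differentiableWithinAt_deriv_pressure_criticalBeta hd
    ((h1.differentiableAt one_ne_zero).differentiableWithinAt)

/-- **THE PRESSURE SURFACE IS NOT `C²` AT THE CRITICAL POINT** (`d ≥ 2`): `¬ ContDiffAt ℝ 2 (fun (β,h) => ψ(β,h)) (β_c, 0)`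
(its restriction to the critical isotherm `β = β_c` is not twice differentiable at `h = 0`). Together with
`hasFDerivAt_pressure_of_le_criticalBeta` (differentiability AT `(β_c,0)`): a continuous (second-order) transition with a
divergent second derivative. [cite: AizenmanBarskyFernandezJSP1987, Thm. 1; AizenmanDuminilCopinSidoraviciusCMP2015, Thm. 1.2; Ellis2006, Thm. V.8.3] -/
theorem not_contDiffAt_two_pressure_uncurry_criticalBeta (hd : 2 ≤ d) :
    ¬ ContDiffAt ℝ 2 (fun p : ℝ × ℝ => pressure d p.1 p.2) (criticalBeta d, 0) := by
  intro h2
  -- restrict to the line `t ↦ (β_c, t)`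
  have hline : ContDiffAt ℝ 2 (fun t : ℝ => ((criticalBeta d, t) : ℝ × ℝ)) 0 := contDiffAt_const.prodMk contDiffAt_id
  have hcomp := h2.comp 0 hline
  exact not_contDiffAt_two_pressure_field_criticalBeta hd (by simpa [Function.comp_def] using hcomp)

end IsingPressure

end Summit.CriticalPhenomena.PercolationContinuityZ3.Theorems.FK

end
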